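import Summits.SmoothPoincare4.SmoothPoincare4.Theses.TropicalFanoSkeleton
import Literature.Topology.FourManifolds.ComplexLinkStar
import Literature.Topology.FourManifolds.HomotopyS4CompactProofs
import HarnessLib

/-!
# Line `birth` — BC3 skeleton for the crux `TropicalFanoSkeleton.TropicalBall` (stmt-SmoothPoincare4-15644)

Registered skeleton (planner, mode `skeleton-register`, route re-audit bin REPAIRABLE) for the rank-3
crux `Summit.SmoothPoincare4.SmoothPoincare4.Theses.TropicalFanoSkeleton.TropicalBall` of
route-SmoothPoincare4-TropicalFanoSkeleton: three named stubs `stub_whiteheadTriangulation`,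
`stub_localFans`, `stub_subordinatePositiveShears` (statements `WhiteheadTriangulation`, `LocalFans`,
`SubordinatePositiveShears`, named below — the ONLY sorries of the file) and the kernel-checked
composition
`TropicalBall_of : Registered.stub_whiteheadTriangulation → Registered.stub_localFans →
Registered.stub_subordinatePositiveShears → TropicalBall`
(conclusion = the crux BY NAME; hypotheses = the stub statements under the registered stub names, the
`Registered` alias device of `Cruxes/DepthTwoRung/Lines/birth.lean`; axioms of `TropicalBall_of`:
`propext, Classical.choice, Quot.sound`).  A prover closing a stub re-declares the `def`s of this
file verbatim in its Theorems file and proves `theorem stub_<name> : <Statement>`.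

## The crux

`TropicalBall` (existence half of the thesis `TropicalBall ∧ TropicalCollapse`): every smooth homotopy
4-sphere `M` (Hausdorff, second countable, `C^∞` atlas on `ℝ⁴`, `M ≃ₕ S⁴` — the bare carriers of
`SmoothPoincare4`) admits a Whitehead smooth triangulation `h : |K| ≃ₜ M` by a finite complex
`K ⊆ ℝᴺ` (`Literature.Topology.FourManifolds.IsSmoothTriangulation 4 K h`), a vertex `v₀` ("at
infinity") and chart vectors `x : ℝᴺ → ℝᴺ → ℝ⁴` forming a POSITIVE INTEGRAL TROPICAL FAN DATUM on
`(K, v₀)`: (I) `x a w ∈ ℤ⁴`; (D) `x a a = 0`; (L) at every vertex `a ≠ v₀` the vectors `x a w` span a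
complete, projective, unimodular simplicial fan with the face structure of the star of `a`; (S) across
every codimension-one face the two chart transitions differ by a Gross–Siebert positive shear
`T = id + κ ⟨·, ď_ρ⟩ d_ω`, `κ ≥ 0`.  The ~2000-character inlined predicate is abbreviated here by
VERBATIM copies `LocalFan` (clause (L) at one vertex), `PositiveShears` (clause (S)) and `FanDatum`
((I) ∧ (D) ∧ (L) ∧ (S)), so that `TropicalBall` unfolds DEFINITIONALLY to
`∀ M …, M ≃ₕ S⁴ → ∃ N K h, IsSmoothTriangulation 4 K h ∧ ∃ v₀ ∈ K, ∃ x, FanDatum N K v₀ x` — checked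
by `Iff.rfl` (`tropicalBall_iff`).

Standing of the crux (route file + item record, 2026-08-17): rank 3, open, ungrounded beyond the
gate's `ground.unused-binder` flag; "zero slack" — with `TropicalCollapse` and
`CertificateRecognition` it gives `SmoothPoincare4` (`closes` of the route file), so an exotic `Σ`
carries no such datum if those hold; non-vacuity for `S⁴` is the support item
`SimplexTropicalCalibration` (`∂Δ⁵`, fans of `ℙ⁴`, `κ = 5`).  `ledger crux ls`: no `Disproof.lean`,
no `Lines/*`, no `Negative/*`; `ledger negatives --problem SmoothPoincare4`: 0 refuted statements.

## The line: local fans first, positive shears second — subordinate to a Whitehead triangulation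

The route header's TWO-LAYER PLAN reads `TropicalBall ⇐ LocalFans (every PL 4-ball admits complete
projective unimodular fan structures at all vertices after subdivision — links are PL 3-spheres;
provable) → ShearExtension (the global CSP: choose the charts so that all codimension-one monodromies
are positive shears) → TropicalBall`.  This skeleton types that plan, with one sharpening that makes
the two halves genuinely different statements and the hard half STRONGER than the crux rather than a
rewording of it: everything is done SUBORDINATE to a given smooth triangulation (the output complex is
a subdivision, `Literature.Topology.FourManifolds.IsSubdivision K K'`, of the input complex).

* `WhiteheadTriangulation` / `stub_whiteheadTriangulation` — KNOWN (Whitehead 1940 Thm. 7, Munkres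
  1966 Thm. 10.6), size L–XL: a compact smooth 4-manifold is smoothly triangulated by a finite
  Euclidean complex.  The tree PROVES the atlas form (`exists_isPLManifold_isWhiteheadCompatible_holds`);
  the finite-complex form is the remaining step.
* `LocalFans` / `stub_localFans` — the LOCAL half, believed PROVABLE (size XL): every smooth
  triangulation of a smooth 4-manifold has a subdivision, again a smooth triangulation, carrying
  integral chart vectors with a complete projective unimodular fan at EVERY vertex (no exceptional
  vertex, no compatibility between charts — hence no hypothesis on `M`).  Engine: links are PL
  3-spheres; derived subdivisions make PL spheres polytopal (Adiprasito–Izmestiev 2015); rational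
  perturbation; toric resolution by star subdivisions keeps projectivity (Cox–Little–Schenck
  Thm. 11.1.9), interleaved vertex by vertex.
* `SubordinatePositiveShears` / `stub_subordinatePositiveShears` — the GLOBAL half, OPEN, the
  LOAD-BEARING stub: on a smooth homotopy 4-sphere, a smooth triangulation with integral local fans at
  all vertices has a subdivision (again a smooth triangulation) carrying a vertex at infinity `v₀` and
  a full `FanDatum` — the route's "ShearExtension" as an obstruction/extension problem over the
  skeleta of the GIVEN complex (modify the given fans by `GL₄(ℤ)` changes, mutations and stellar
  refinements = toric blow-ups until every wall transition is a positive shear).  It implies the crux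
  with the two other stubs (this file) and is not known to follow from it (that would need Whitehead
  uniqueness + invariance of fan data under common stellar refinement).
* `TropicalBall_of` — the REAL composition (pure logic): `M ≃ₕ S⁴` makes `M` compact
  (`compactSpace_of_homotopyEquiv_sphere_four_holds`, Hatcher 3.29, PROVED in the tree); stub 1 gives
  `K`; stub 2 refines it to `K₁` with local fans `x`; stub 3 refines `K₁` to `K'` with `v₀`, `x'` and
  `FanDatum N K' v₀ x'`, which IS the crux's predicate.

Each stub is a genuine lemma of the line: stub 1 is a published theorem, stub 2 a statement about ALL
smooth 4-manifolds (so it cannot be the crux or the summit, both of which single out homotopy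
spheres), stub 3 carries an extra hypothesis (local fans on the given `K`) and a stronger conclusion
(subdivision of the given `K`) than the crux.  BC3 probes (planner folder `bc/probe_<Stmt>.lean`,
2026-08-17, farm `lean check`, `maxHeartbeats 400000` each): for each stub statement `S`,
`example : S → TropicalBall` and `example : S → SmoothPoincare4` by `first | exact? | simpa | aesop`
FAIL (6/6: "unsolved goals", aesop "failed to prove the goal after exhaustive search"), and the
unfolded single-tactic variants (`simpa [S, TropicalBall, FanDatum, LocalFan, PositiveShears]`,
`unfold S TropicalBall; aesop`, and the two analogues against the unfolded `SmoothPoincare4`) FAIL too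
(12/12: `assumption` failed / whnf or simp timeout at 400000 heartbeats / unsolved goal
`HomotopyEquiv.NonemptyDiffeomorphSphere M 4`).  No stub is cheaply the crux or the summit.

Disproof used: none relevant — no `Disproof.lean`, no `_false_without_` theorem and no landed
`Theorems/TropicalBall/Negative/*` lemma exist for this crux at registration (2026-08-17); the
negatives index of the summit is empty.  Vacuity pass done here: `LocalFans` and
`SubordinatePositiveShears` quantify over possibly EMPTY complexes (`M = ∅`), where they hold
trivially / are never invoked by the composition (a homotopy sphere is nonempty); the local-fan
hypothesis of stub 3 is satisfiable (`K = ∂Δ⁵`, fans of `ℙ⁴` at all six vertices), so stub 3 is not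
vacuous; no hand-picked thresholds, no integrals, no gauge-dependent matrix entries (typing checklist
4c (i)–(iv) n/a).
-/

noncomputable section

open scoped BigOperators Topology Manifold Classical MeasureTheory ProbabilityTheory Matrix InnerProductSpace ComplexConjugate ContinuousMap ContDiff
open Filter Set Function TopologicalSpace MeasureTheory
open Literature.Topology.FourManifolds (IsSmoothTriangulation IsSubdivision
  compactSpace_of_homotopyEquiv_sphere_four_holds)
open Summit.SmoothPoincare4.SmoothPoincare4.Theses.TropicalFanoSkeleton (TropicalBall)

-- `Summit.<Summit>.<Problem>`: for the single-conjunct summit the duplicate segment is mandated.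
set_option linter.dupNamespace false
set_option linter.unusedVariables false

namespace Summit.SmoothPoincare4.SmoothPoincare4.Cruxes.TropicalBall.Birth

/-! ## Vocabulary — VERBATIM pieces of the crux (so that `TropicalBall` unfolds to them definitionally;
`tropicalBall_iff` below is `Iff.rfl`) -/

/-- **Local fan at the vertex `a`** (clause (L) of the crux at one vertex, verbatim): the integer edge
vectors `x a w` (`w` running over the vertices `≠ a` of the faces of `K` through `a`; the vertex at
infinity, when adjacent, is just one more ray) generate a COMPLETE, PROJECTIVE, UNIMODULAR SIMPLICIAL
FAN in `ℝ⁴` whose face structure is the star of `a`: (U) every 4-simplex through `a` gives a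
`ℤ`-basis; (Int) cones meet along the cone of the common face; (C) the cones cover `ℝ⁴`; (P) a
strictly convex conewise-linear support function `m` exists (linearity domains = the maximal cones).
This is the fan of a smooth projective toric 4-fold with rays ↔ the vertices of `lk(a)`. -/
def LocalFan (N : ℕ) (K : Geometry.SimplicialComplex ℝ (EuclideanSpace ℝ (Fin N)))
    (x : EuclideanSpace ℝ (Fin N) → EuclideanSpace ℝ (Fin N) → (Fin 4 → ℝ))
    (a : EuclideanSpace ℝ (Fin N)) : Prop :=
  (∀ σ ∈ K.faces, a ∈ σ → σ.card = 5 → ∀ f : Fin 4 → EuclideanSpace ℝ (Fin N), Function.Injective f → (∀ i, f i ∈ σ.erase a) → |Matrix.det (Matrix.of fun i j => x a (f i) j)| = 1) ∧ (∀ τ ∈ K.faces, ∀ τ' ∈ K.faces, a ∈ τ → a ∈ τ' → {y : Fin 4 → ℝ | ∃ c : EuclideanSpace ℝ (Fin N) → ℝ, (∀ w, 0 ≤ c w) ∧ y = ∑ w ∈ (τ).erase a, c w • x a w} ∩ {y : Fin 4 → ℝ | ∃ c : EuclideanSpace ℝ (Fin N) → ℝ, (∀ w, 0 ≤ c w) ∧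 y = ∑ w ∈ (τ').erase a, c w • x a w} = {y : Fin 4 → ℝ | ∃ c : EuclideanSpace ℝ (Fin N) → ℝ, (∀ w, 0 ≤ c w) ∧ y = ∑ w ∈ (τ ∩ τ').erase a, c w • x a w}) ∧ (⋃ τ ∈ {τ ∈ K.faces | a ∈ τ}, {y : Fin 4 → ℝ | ∃ c : EuclideanSpace ℝ (Fin N) → ℝ, (∀ w, 0 ≤ c w) ∧ y = ∑ w ∈ (τ).erase a, c w • x a w}) = Set.univ ∧ (∃ m : Finset (EuclideanSpace ℝ (Fin N)) → (Fin 4 → ℝ), ∀ σ ∈ K.faces, ∀ σ' ∈ K.faces, a ∈ σ → a ∈ σ' → σ.card = 5 → σ'.card = 5 → ∀ y ∈ {y : Fin 4 → ℝ | ∃ c : EuclideanSpace ℝ (Fin N) → ℝ, (∀ w, 0 ≤ c w) ∧ y = ∑ w ∈ (σ).erase a, c w • x a w}, (∑ i, m σ' i * y i ≤ ∑ i, m σ i * y i) ∧ ((∑ i, m σ' i * y i = ∑ i, m σ i * y i) → y ∈ {y : Fin 4 → ℝ | ∃ c : EuclideanSpace ℝ (Fin N) → ℝ, (∀ w, 0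 ≤ c w) ∧ y = ∑ w ∈ (σ').erase a, c w • x a w}))

/-- **Positive shear monodromy** (clause (S) of the crux, verbatim): for every codimension-one face
`ρ` (4 vertices) with two distinct cofaces `σp ≠ σm` and vertices `a ≠ b` of `ρ`, both `≠ v₀`, the
transition "chart at `a` → chart at `b` through `σp`" (`ψp`, the affine map matching the positions of
the vertices of `σp`, the direction of `v₀` being matched by the linear part) and the one through
`σm` (`ψm`) differ by a SHEAR along the edge vector `x a b` governed by the conormal of `ρ`, with
coefficient `κ ≥ 0` once the conormal is normalised to be positive on `σp` — the Gross–Siebert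
normal form `T = id + κ ⟨·, ď_ρ⟩ d_ω`, `κ ≥ 0` (arXiv:math/0309070 §1.5; GrossSiebert2011 §1.1,
Def. 1.4). -/
def PositiveShears (N : ℕ) (K : Geometry.SimplicialComplex ℝ (EuclideanSpace ℝ (Fin N)))
    (v₀ : EuclideanSpace ℝ (Fin N))
    (x : EuclideanSpace ℝ (Fin N) → EuclideanSpace ℝ (Fin N) → (Fin 4 → ℝ)) : Prop :=
  (∀ ρ ∈ K.faces, ρ.card = 4 → ∀ σp ∈ K.faces, ∀ σm ∈ K.faces, σp.card = 5 → σm.card = 5 → ρ ⊆ σp → ρ ⊆ σm → σp ≠ σm → ∀ a ∈ ρ, ∀ b ∈ ρ, a ≠ b → a ≠ v₀ → b ≠ v₀ → ∀ ψp ψm : (Fin 4 → ℝ) →ᵃ[ℝ] (Fin 4 → ℝ), (∀ w ∈ σp, w ≠ v₀ → ψp (x a w) = x b w) → (v₀ ∈ σp → ψp.linear (x a v₀) = x b v₀) → (∀ w ∈ σm, w ≠ v₀ → ψm (x a w) = x b w) → (v₀ ∈ σm → ψm.linear (x a v₀) = x b v₀) → ∀ wp ∈ σp, wp ∉ ρ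 → ∀ g : Fin 3 → EuclideanSpace ℝ (Fin N), Function.Injective g → (∀ i, g i ∈ ρ.erase a) → ∃ κ : ℝ, 0 ≤ κ ∧ ∀ y : Fin 4 → ℝ, ψp y = ψm (y + (κ * Matrix.det (Matrix.of ![y, x a (g 0), x a (g 1), x a (g 2)]) * Matrix.det (Matrix.of ![x a wp, x a (g 0), x a (g 1), x a (g 2)])) • x a b))

/-- **Positive integral tropical fan datum on `(K, v₀)`** — the full predicate under `∃ x` in the
crux, verbatim up to the two abbreviations above: (I) integrality of all chart vectors, (D)
`x a a = 0` (each chart is centred at its own vertex), (L) a local fan at every vertex `a ≠ v₀`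
(`v₀` is the vertex at infinity and carries no chart), (S) positive shear monodromy. -/
def FanDatum (N : ℕ) (K : Geometry.SimplicialComplex ℝ (EuclideanSpace ℝ (Fin N)))
    (v₀ : EuclideanSpace ℝ (Fin N))
    (x : EuclideanSpace ℝ (Fin N) → EuclideanSpace ℝ (Fin N) → (Fin 4 → ℝ)) : Prop :=
  (∀ a w i, ∃ z : ℤ, x a w i = z) ∧ (∀ a, x a a = 0) ∧ (∀ a : EuclideanSpace ℝ (Fin N), ({a} : Finset (EuclideanSpace ℝ (Fin N))) ∈ K.faces → a ≠ v₀ → LocalFan N K x a) ∧ PositiveShears N K v₀ x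

/-- **Canary: the abbreviations are verbatim.** `TropicalBall` unfolds DEFINITIONALLY to "every smooth
homotopy 4-sphere has a smooth triangulation `(N, K, h)`, a vertex `v₀` and an `x` with
`FanDatum N K v₀ x`" — checked by `Iff.rfl`, so the composition below may conclude the crux by name
from data phrased with `FanDatum` / `LocalFan`. -/
theorem tropicalBall_iff :
    TropicalBall ↔
      ∀ (M : Type) [TopologicalSpace M] [T2Space M] [SecondCountableTopology M]
        [ChartedSpace (EuclideanSpace ℝ (Fin 4)) M] [IsManifold (𝓡 4) (⊤ : ℕ∞) M],
        M ≃ₕ Metric.sphere (0 : EuclideanSpace ℝ (Fin 5)) 1 →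
          ∃ (N : ℕ) (K : Geometry.SimplicialComplex ℝ (EuclideanSpace ℝ (Fin N))) (h : K.space ≃ₜ M),
            IsSmoothTriangulation 4 K h ∧
              ∃ v₀ : EuclideanSpace ℝ (Fin N), ({v₀} : Finset (EuclideanSpace ℝ (Fin N))) ∈ K.faces ∧
                ∃ x : EuclideanSpace ℝ (Fin N) → EuclideanSpace ℝ (Fin N) → (Fin 4 → ℝ), FanDatum N K v₀ x :=
  Iff.rfl

/-! ## The three stub STATEMENTS (named) -/

/-- **`WhiteheadTriangulation`** (statement of `stub_whiteheadTriangulation`; KNOWN — J. H. C.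
Whitehead 1940, Thm. 7 / Munkres 1966, Thm. 10.6, in the finite-Euclidean-complex form; size L–XL):
every COMPACT Hausdorff second-countable `C^∞` 4-manifold modelled on `ℝ⁴` is smoothly triangulated
(`IsSmoothTriangulation 4 K h`: finitely many simplices, `h` extends near each closed simplex to a
`C^∞` map of maximal rank on its plane) by a finite simplicial complex `K` in some `ℝᴺ`.  The tree
already PROVES the atlas form — a Whitehead-compatible PL structure on every Hausdorff second
countable smooth manifold (`exists_isPLManifold_isWhiteheadCompatible_holds`,
`WhiteheadTriangulation.lean`); what remains is the passage "PL atlas on a compact manifold ⇒ one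
finite Euclidean complex" (finitely many PL charts, common subdivision, linear embedding of a finite
complex in `ℝᴺ`, `N` = number of vertices).  Why it might fail: it does not (published theorem); only
vendoring fidelity of `IsSmoothTriangulation` (Munkres Def. 8.3 verbatim).
[cite: Whitehead1940, Thm. 7] [cite: Munkres1966, Thm. 10.6] -/
def WhiteheadTriangulation : Prop :=
  ∀ (M : Type) [TopologicalSpace M] [T2Space M] [SecondCountableTopology M]
    [ChartedSpace (EuclideanSpace ℝ (Fin 4)) M] [IsManifold (𝓡 4) (⊤ : ℕ∞) M] [CompactSpace M],
    ∃ (N : ℕ) (K : Geometry.SimplicialComplex ℝ (EuclideanSpace ℝ (Fin N))) (h : K.space ≃ₜ M),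
      IsSmoothTriangulation 4 K h

/-- **`LocalFans`** (statement of `stub_localFans`; the LOCAL half of the route header's two-layer plan
"TropicalBall ⇐ LocalFans → ShearExtension"; believed PROVABLE on paper, size XL in Lean): every smooth
triangulation `K ⊆ ℝᴺ` of a smooth 4-manifold `M` has a SUBDIVISION `K'` (`IsSubdivision K K'`: same
polyhedron, every simplex of `K'` inside a simplex of `K`), again a smooth triangulation of `M`, which
carries integral chart vectors `x` (clauses (I), (D)) forming a LOCAL FAN AT EVERY VERTEX (clause (L)
with no exceptional vertex) — no compatibility whatsoever between the charts at different vertices is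
asked, so there is no global obstruction and no hypothesis on `M`.  Mechanism: vertex links of a smooth
triangulation are PL 3-spheres (Whitehead 1940 / Munkres §8 Ex. (a), tree fact
`Munkres1966_8_4_links_of_smoothTriangulation`); after finitely many derived subdivisions every PL
sphere is polytopal (Adiprasito–Izmestiev, arXiv:1311.2965, Thm. I), a simplicial polytope perturbs to a
rational one with the same face lattice, its face fan is complete, simplicial and projective, and
star subdivisions make it unimodular keeping projectivity (toric resolution, Cox–Little–Schenck
Thm. 11.1.9) — performed vertex by vertex on `K'` itself (a star subdivision at a cone of the star of
`a` is a stellar subdivision of `K'`; at an already treated neighbour it is a smooth blow-up, at an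
untreated one it keeps the link polytopal); subdivisions of a smooth triangulation are smooth
triangulations (`vectorSpan s' ≤ vectorSpan s`).  Why it might fail: the simultaneous polytopality of
ALL links of ALL faces after one common subdivision needs the Adiprasito–Izmestiev theorem in a
relative/iterated form, and the interleaving of resolutions must terminate — bookkeeping risks, not a
known obstruction; the statement holds vacuously for `K = ∅`.
[cite: AdiprasitoIzmestiev2015, Thm. I (arXiv:1311.2965)] [cite: CoxLittleSchenck2011, Thm. 11.1.9]
[cite: Munkres1966, §8 Ex. (a)] -/
def LocalFans : Prop :=
  ∀ (M : Type) [TopologicalSpace M] [T2Space M] [SecondCountableTopology M]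
    [ChartedSpace (EuclideanSpace ℝ (Fin 4)) M] [IsManifold (𝓡 4) (⊤ : ℕ∞) M]
    (N : ℕ) (K : Geometry.SimplicialComplex ℝ (EuclideanSpace ℝ (Fin N))) (h : K.space ≃ₜ M),
    IsSmoothTriangulation 4 K h →
      ∃ K' : Geometry.SimplicialComplex ℝ (EuclideanSpace ℝ (Fin N)), IsSubdivision K K' ∧
        ∃ h' : K'.space ≃ₜ M, IsSmoothTriangulation 4 K' h' ∧
          ∃ x : EuclideanSpace ℝ (Fin N) → EuclideanSpace ℝ (Fin N) → (Fin 4 → ℝ),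
            (∀ a w i, ∃ z : ℤ, x a w i = z) ∧ (∀ a, x a a = 0) ∧
              ∀ a : EuclideanSpace ℝ (Fin N), ({a} : Finset (EuclideanSpace ℝ (Fin N))) ∈ K'.faces →
                LocalFan N K' x a

/-- **`SubordinatePositiveShears`** (statement of `stub_subordinatePositiveShears`; the GLOBAL half —
the route header's "ShearExtension (the global CSP: choose the charts so that all codimension-one
monodromies are positive shears)", made SUBORDINATE to the given triangulation; OPEN, crux-hard, the
load-bearing stub): if `M` is a smooth homotopy 4-sphere and `K` a smooth triangulation of `M` carrying
integral local fans `x` at all vertices (the output of `LocalFans`), then some SUBDIVISION `K'` of `K`,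
again a smooth triangulation of `M`, carries a vertex `v₀` and a full positive integral tropical fan
datum `x'` (`FanDatum`: local fans at all vertices `≠ v₀` AND positive shear monodromy across every
codimension-one face) — the discrete fan-picture data of a tropical 4-manifold `|K'| ∖ v₀` with one
conical end over `lk(v₀)`.  Intended mechanism: an obstruction theory over the skeleta of `K`,
modifying the given local fans by `GL₄(ℤ)` changes, mutations and stellar refinements (toric
blow-ups) until every wall transition is a positive shear; the homotopy-sphere hypothesis is where the
rigidity must enter (by `TropicalCollapse` + recognition no other closed 4-manifold can carry such
data).  Logical standing: with `WhiteheadTriangulation` and `LocalFans` it implies the crux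
(`TropicalBall_of`); it is STRONGER than the crux as far as known (subordination to an arbitrary
smooth triangulation would follow from the crux only via Whitehead uniqueness + invariance of fan
data under common stellar refinement, both unproved here); like the crux it has zero slack against
SPC4.  Why it might fail: (i) everything that can make the crux fail (an exotic `Σ` carries no such
data if `TropicalCollapse` holds; no mechanism yet produces shear-positive charts from a handle or
triangulation structure — even for `S⁴` only `∂Δ⁵`/the quintic 4-fold structure, `κ = 5`, is in hand);
(ii) additionally, positive data might exist on some triangulation of `M` but on no subdivision of a
given one (failure of refinement invariance at vertices created on the discriminant locus).
[cite: GrossSiebert2011, §1.1, Def. 1.4, Thm. 1.29] [cite: GrossSiebert2006, arXiv:math/0309070, §1.5]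
[cite: FernexKollarXu2012, Thm. 41] [cite: MauriMoraga2024] -/
def SubordinatePositiveShears : Prop :=
  ∀ (M : Type) [TopologicalSpace M] [T2Space M] [SecondCountableTopology M]
    [ChartedSpace (EuclideanSpace ℝ (Fin 4)) M] [IsManifold (𝓡 4) (⊤ : ℕ∞) M],
    M ≃ₕ Metric.sphere (0 : EuclideanSpace ℝ (Fin 5)) 1 →
      ∀ (N : ℕ) (K : Geometry.SimplicialComplex ℝ (EuclideanSpace ℝ (Fin N))) (h : K.space ≃ₜ M),
        IsSmoothTriangulation 4 K h →
          ∀ x : EuclideanSpace ℝ (Fin N) → EuclideanSpace ℝ (Fin N) → (Fin 4 → ℝ),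
            (∀ a w i, ∃ z : ℤ, x a w i = z) → (∀ a, x a a = 0) →
              (∀ a : EuclideanSpace ℝ (Fin N), ({a} : Finset (EuclideanSpace ℝ (Fin N))) ∈ K.faces →
                LocalFan N K x a) →
                ∃ K' : Geometry.SimplicialComplex ℝ (EuclideanSpace ℝ (Fin N)), IsSubdivision K K' ∧
                  ∃ h' : K'.space ≃ₜ M, IsSmoothTriangulation 4 K' h' ∧
                    ∃ v₀ : EuclideanSpace ℝ (Fin N),
                      ({v₀} : Finset (EuclideanSpace ℝ (Fin N))) ∈ K'.faces ∧
                        ∃ x' : EuclideanSpace ℝ (Fin N) → EuclideanSpace ℝ (Fin N) → (Fin 4 → ℝ),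
                          FanDatum N K' v₀ x'

/-! ## Stubs (the ONLY sorries of this file) -/

/-- Stub 1 — Whitehead's triangulation theorem, finite-complex form (registered obligation; statement
`WhiteheadTriangulation`; KNOWN). [cite: Munkres1966, Thm. 10.6] -/
theorem stub_whiteheadTriangulation : WhiteheadTriangulation := by
  sorry

/-- Stub 2 — local fans on a subdivision (registered obligation; statement `LocalFans`; believed
provable). [cite: AdiprasitoIzmestiev2015, Thm. I] [cite: CoxLittleSchenck2011, Thm. 11.1.9] -/
theorem stub_localFans : LocalFans := by
  sorry

/-- Stub 3 — subordinate positive shear extension (registered obligation; statement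
`SubordinatePositiveShears`; OPEN, the hardest stub). [cite: GrossSiebert2011, Thm. 1.29] -/
theorem stub_subordinatePositiveShears : SubordinatePositiveShears := by
  sorry

/-! ## Name-keyed aliases of the stub statements (hypotheses of the composition)

`Registered.stub_X` is the statement of `stub_X` under the registered stub's short name, so that the
native skeleton audit (`#h21_check_skeleton`: hypotheses admissible iff registered obligations /
declared stubs BY NAME) accepts `TropicalBall_of` below (device of
`Cruxes/DepthTwoRung/Lines/birth.lean`). -/
namespace Registered

/-- Alias of `WhiteheadTriangulation` (= the statement of `stub_whiteheadTriangulation`). -/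
abbrev stub_whiteheadTriangulation : Prop := WhiteheadTriangulation
/-- Alias of `LocalFans` (= the statement of `stub_localFans`). -/
abbrev stub_localFans : Prop := LocalFans
/-- Alias of `SubordinatePositiveShears` (= the statement of `stub_subordinatePositiveShears`). -/
abbrev stub_subordinatePositiveShears : Prop := SubordinatePositiveShears

end Registered

/-! ## Composition (real proof — no `sorry` below this line) -/

/-- **THE SKELETON THEOREM.** The crux
`Summit.SmoothPoincare4.SmoothPoincare4.Theses.TropicalFanoSkeleton.TropicalBall`, concluded BY NAME
from the three declared stubs: a homotopy 4-sphere `M` is compact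
(`compactSpace_of_homotopyEquiv_sphere_four_holds`, Hatcher Prop. 3.29, PROVED in the tree), so
`WhiteheadTriangulation` gives a smooth triangulation `K` of `M`; `LocalFans` refines it to `K₁` with
integral local fans `x` at every vertex; `SubordinatePositiveShears` refines `K₁` to `K'` with a vertex
at infinity `v₀` and a full positive integral tropical fan datum `x'`; `FanDatum N K' v₀ x'` IS the
crux's predicate (`tropicalBall_iff`).  Pure logic; standard axioms only. -/
theorem TropicalBall_of :
    Registered.stub_whiteheadTriangulation → Registered.stub_localFans →
      Registered.stub_subordinatePositiveShears → TropicalBall := by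
  intro hW hL hS M _ _ _ _ _ e
  -- a homotopy 4-sphere is compact (Hatcher 3.29, proved in the tree)
  haveI : CompactSpace M := compactSpace_of_homotopyEquiv_sphere_four_holds M e
  -- stub 1: a smooth triangulation `K ⊆ ℝᴺ` of `M`
  obtain ⟨N, K, h, hK⟩ := hW M
  -- stub 2: a subdivision `K₁` of `K` with integral local fans `x` at every vertex
  obtain ⟨K₁, -, h₁, hK₁, x, hxI, hxD, hxL⟩ := hL M N K h hK
  -- stub 3: a subdivision `K'` of `K₁`, a vertex at infinity `v₀` and the full positive datum `x'`
  obtain ⟨K', -, h', hK', v₀, hv₀, x', hx'⟩ := hS M e N K₁ h₁ hK₁ x hxI hxD hxL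
  exact ⟨N, K', h', hK', v₀, hv₀, x', hx'⟩

/-- Wiring check: the registered stubs feed `TropicalBall_of` exactly as stated, so the skeleton is
`TropicalBall` closed modulo the three stubs (sorries enter only through them). -/
example : TropicalBall :=
  TropicalBall_of stub_whiteheadTriangulation stub_localFans stub_subordinatePositiveShears

end Summit.SmoothPoincare4.SmoothPoincare4.Cruxes.TropicalBall.Birth

end
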